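import Summits.ResolutionOfSingularities.ResolutionOfSingularities.Theorems.HilbertSamuelEliminationSigmaMaxModificationsCorridor3SigmaMenuDiscipline
import Literature.AlgebraicGeometry.Resolution.PrincipalStrictTransform
import Literature.AlgebraicGeometry.Resolution.HypersurfaceRestrictionTransform
import HarnessLib

/-!
# [OURS · L1 W4.2] σ-LAYER — `Corridor3SigmaBoundaryCoincidence`: WHEN THE RUN'S BOUNDARY IS THE CJS BOUNDARY — the member-level coincidence
# «member transform of record = CJS principal strict transform», its two CHARACTERISATIONS (off the member: the total transform is already the strict
# transform; on the member: the factorisation `𝓘_E · B̃ = π^* B` of CJS (5.3)), `E.next C = completeTransformList` under it, and the run-level NAMED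
# OBLIGATION `StrategyE.IsTransformCoincidentOnE` (res-L1-w42-plan-1 RULING v3.14-37 (JD) / WORD 16:10:27Z «(R-iii) COINCIDENCE»; crux chain w42
# `SigmaMaxModifications` stmt-ResolutionOfSingularities-18506 / conjunct `SigmaMaxModificationsCorridor3` stmt-ResolutionOfSingularities-19249)

OURS (cell res-hironaka, slot W4.2; typer res-L1-type-o1 g9); NOT statements of H. Hironaka's manuscript [Hironaka2017] nor of [CossartJannsenSaito2020];
AI-typed, weaker than expert review. Helper VOCABULARY `--supports stmt-ResolutionOfSingularities-19249 --as helper` (counted 0). Additive over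
`…SigmaBoundaryDefs` v5 (`Boundary.memberTransform`, `Boundary.next_eq_map_memberTransform`; imported through `…SigmaMenuDiscipline` for `StrategyE.hybrid`) and `Literature…PrincipalStrictTransform` (p544553:
`principalStrictTransform`, `completeTransformList`, `comap_centre_mul_principalStrictTransform_of_le`).

## What and why

The σ-run's boundary update `Boundary.next` applies the scheme-theoretic strict transform `B̃` (tree `strictTransformIdeal`) to every member; CJS's
boundary OF RECORD (LNM 2270 Def. 5.5/5.7) applies the PRINCIPAL strict transform `B'`. The gate refuses an in-place switch (`theorems.append-only`), and
the planner's route of record is COINCIDENCE: prove `B̃ = B'` where the run needs it. Stalk-locally (`X = Spec A`, `C = V(𝔭)`, `B = V(f)`, LNM (5.6)):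
`B̃ ↔ ⊕ₙ f·(𝔭ⁿ : f)` versus `B' ↔ ⊕ₙ f𝔭ⁿ` (`f ∉ 𝔭`) / `⊕ₙ f𝔭ⁿ⁻¹` (`f ∈ 𝔭`). This file types the TARGET of that programme, not its dischargers:

* §1 `Boundary.MemberCoincides C B` («`memberTransform C B = principalStrictTransform (blowup.π C) C B`»), `Boundary.Coincides E C` (every member),
  **`Boundary.next_eq_completeTransformList_of_coincides`** (then `E.next C` IS CJS's complete transform `{B₁', …, Bₙ', E}`), list bookkeeping.
* §2 THE TWO CHARACTERISATIONS: **`memberCoincides_iff_of_not_le`** (`¬ B ≤ C`: coincidence ⟺ `B̃ = π^* B`, the total transform is already saturated —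
  dischargeable from NORMAL FLATNESS of `W` along `C`, i.e. for permissible centres: `Ass(A/𝔭ⁿ) = {𝔭}`; not proved here) and
  **`memberCoincides_iff_of_le`** (`B ≤ C`: coincidence ⟺ `𝓘_E · B̃ = π^* B` — EXACTLY the factorisation hypothesis of res-type-067's
  `comap_strictTransformHom_strictTransformIdeal_of_mul_eq` (p542701); equivalently `in_𝔭(f)` is `gr_𝔭(A)`-regular — near-point theory, not proved here;
  it FAILS for a member singular along the centre, e.g. `W' = V(e·y₁ − z₁³)`, `E = V(e)`, centre the origin: `E' = V(εζ³) ⊋ Ẽ = V(ζ³)`).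
* §3 the run-level NAMED OBLIGATION **`StrategyE.IsTransformCoincidentOnE 𝒮 N ν σ`** (sibling of `IsAdmissibleStrategyOnE`: at states in scope every
  allowed step's centre satisfies `E.Coincides C`), its `hybrid` closure, and the one-step consequence for σE-chains
  (`CanonicalNearStepσE.next_E_eq_completeTransformList`): under the obligation the boundary of the next stage is the CJS complete transform.
-/

noncomputable section

set_option linter.dupNamespace false -- mandated namespace of this single-conjunct summit

open CategoryTheory AlgebraicGeometry TopologicalSpace
open Summit.ResolutionOfSingularities.ResolutionOfSingularities.Theorems.CampaignW42
open Literature.AlgebraicGeometry.Resolution Literature.RingTheory.HilbertSamuel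

namespace Summit.ResolutionOfSingularities.ResolutionOfSingularities.Theorems.SigmaMaxModificationsCorridor3.Sigma

universe u

/-! ## §1. Member-level coincidence and the complete transform -/

section Member

variable {W : Scheme.{u}}

/-- [OURS · L1 W4.2] **THE MEMBER `B` COINCIDES under the blow-up of `C`**: the run's member transform of `B` (currently the scheme-theoretic strict
transform `B̃`) IS CJS's principal strict transform `B'` (LNM 2270 Def. 5.5). NOT a statement of the manuscript. [folklore] -/
def Boundary.MemberCoincides (C B : W.IdealSheafData) : Prop :=
  Boundary.memberTransform C B = principalStrictTransform (blowup.π C) C B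

/-- [OURS · L1 W4.2] **THE BOUNDARY `E` COINCIDES under the blow-up of `C`**: every member does. NOT a statement of the manuscript. [folklore] -/
def Boundary.Coincides (E : Boundary W) (C : W.IdealSheafData) : Prop :=
  ∀ B ∈ E, Boundary.MemberCoincides C B

/-- Unfolding (`Iff.rfl`). [folklore] -/
theorem Boundary.memberCoincides_iff (C B : W.IdealSheafData) :
    Boundary.MemberCoincides C B ↔ Boundary.memberTransform C B = principalStrictTransform (blowup.π C) C B :=
  Iff.rfl

/-- **UNDER COINCIDENCE THE RUN'S NEXT BOUNDARY IS CJS's COMPLETE TRANSFORM** `{B₁', …, Bₙ', E}` (LNM 2270 Def. 5.7). [folklore] -/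
theorem Boundary.next_eq_completeTransformList_of_coincides {E : Boundary W} {C : W.IdealSheafData} (h : E.Coincides C) :
    E.next C = completeTransformList (blowup.π C) C E := by
  rw [Boundary.next_eq_map_memberTransform, completeTransformList, List.map_congr_left h]

/-- The empty boundary coincides. [folklore] -/
theorem Boundary.coincides_nil (C : W.IdealSheafData) : Boundary.Coincides ([] : Boundary W) C :=
  fun _ h => absurd h List.not_mem_nil

/-- Coincidence of a cons. [folklore] -/
theorem Boundary.coincides_cons_iff {B : W.IdealSheafData} {E : Boundary W} {C : W.IdealSheafData} :
    Boundary.Coincides (B :: E) C ↔ Boundary.MemberCoincides C B ∧ Boundary.Coincides E C := by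
  simp [Boundary.Coincides]

/-- Coincidence of an append. [folklore] -/
theorem Boundary.coincides_append_iff {E₁ E₂ : Boundary W} {C : W.IdealSheafData} :
    Boundary.Coincides (E₁ ++ E₂) C ↔ Boundary.Coincides E₁ C ∧ Boundary.Coincides E₂ C := by
  simp only [Boundary.Coincides, List.mem_append, or_imp, forall_and]

/-- Coincidence passes to sub-boundaries. [folklore] -/
theorem Boundary.Coincides.mono {E E' : Boundary W} {C : W.IdealSheafData} (h : E.Coincides C) (hsub : E' ⊆ E) : E'.Coincides C :=
  fun B hB => h B (hsub hB)

/-- Under member coincidence the member of `E.next C` at an old index is the principal strict transform. [folklore] -/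
theorem Boundary.getElem_next_eq_principalStrictTransform {E : Boundary W} {C : W.IdealSheafData} {m : ℕ} (hm : m < E.length)
    (h : Boundary.MemberCoincides C E[m]) (hm' : m < (E.next C).length := by simp; omega) :
    (E.next C)[m] = principalStrictTransform (blowup.π C) C E[m] := by
  rw [Boundary.getElem_next_of_lt E C hm, h]

end Member

/-! ## §2. The two characterisations -/

section Characterisation

variable {W : Scheme.{u}} {C B : W.IdealSheafData}

/-- **OFF THE MEMBER** (`¬ B ≤ C`, the centre does not lie in `V(B)`): coincidence ⟺ the scheme-theoretic strict transform is the TOTAL transform,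
`B̃ = π^* B` (LNM (5.6), case `f ∉ 𝔭`: `⊕ f(𝔭ⁿ : f) = ⊕ f𝔭ⁿ`; true when `W` is normally flat along `C` — a discharger, not proved here). [folklore] -/
theorem Boundary.memberCoincides_iff_of_not_le (h : ¬ B ≤ C) :
    Boundary.MemberCoincides C B ↔ strictTransformIdeal (blowup.π C) C B = B.comap (blowup.π C) := by
  rw [Boundary.memberCoincides_iff, principalStrictTransform_of_not_le h]
  rfl

/-- **ON THE MEMBER** (`B ≤ C`, the centre lies in `V(B)`): coincidence ⟺ THE FACTORISATION `𝓘_E · B̃ = π^* B` of CJS (5.3) holds for the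
scheme-theoretic strict transform (LNM (5.6), case `f ∈ 𝔭`: `⊕ f(𝔭ⁿ : f) = ⊕ f𝔭ⁿ⁻¹`, i.e. `in_𝔭(f)` is `gr_𝔭`-regular) — exactly the hypothesis of
res-type-067's `comap_strictTransformHom_strictTransformIdeal_of_mul_eq`. Proof: `B'` satisfies the factorisation
(`comap_centre_mul_principalStrictTransform_of_le`) and the exceptional divisor is effective Cartier, hence cancellable
(`IsEffectiveCartier.eq_of_mul_eq_mul`). [folklore] -/
theorem Boundary.memberCoincides_iff_of_le [IsLocallyNoetherian (blowup C)] (h : B ≤ C) :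
    Boundary.MemberCoincides C B ↔ C.comap (blowup.π C) * strictTransformIdeal (blowup.π C) C B = B.comap (blowup.π C) := by
  have hfac := comap_centre_mul_principalStrictTransform_of_le (blowup.isBlowup C) h
  rw [Boundary.memberCoincides_iff]
  constructor
  · intro hc
    rw [show strictTransformIdeal (blowup.π C) C B = Boundary.memberTransform C B from rfl, hc, hfac]
  · intro hmul
    refine (blowup.isBlowup C).isEffectiveCartier.eq_of_mul_eq_mul ?_
    rw [hfac]
    exact hmul

/-- On the member, coincidence gives the factorisation for the run's member transform. [folklore] -/
theorem Boundary.MemberCoincides.comap_centre_mul_memberTransform [IsLocallyNoetherian (blowup C)] (hc : Boundary.MemberCoincides C B)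
    (h : B ≤ C) : C.comap (blowup.π C) * Boundary.memberTransform C B = B.comap (blowup.π C) := by
  rw [hc]
  exact comap_centre_mul_principalStrictTransform_of_le (blowup.isBlowup C) h

/-- A member of `E.next C` under coincidence lies between the total transform and the scheme-theoretic strict transform (as ideals): restatement of
`comap_le_principalStrictTransform` / `principalStrictTransform_le_strictTransformIdeal` for the run's member. [folklore] -/
theorem Boundary.MemberCoincides.le_strictTransformIdeal (hc : Boundary.MemberCoincides C B) :
    B.comap (blowup.π C) ≤ Boundary.memberTransform C B ∧ Boundary.memberTransform C B ≤ strictTransformIdeal (blowup.π C) C B := by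
  rw [hc]
  exact ⟨comap_le_principalStrictTransform B, principalStrictTransform_le_strictTransformIdeal B⟩

end Characterisation

/-! ## §3. The run-level named obligation -/

section Run

variable {N : ℕ} {ν : ℕ → ℕ}

/-- [OURS · L1 W4.2] **`σ` IS TRANSFORM-COINCIDENT ON THE STATE-SCOPE `𝒮`** (sibling of `IsAdmissibleStrategyOnE`; the planner's (o-D3) obligation in
dischargeable form): at every state in `𝒮`, every step `σ` allows has a centre `C` under which the current boundary COINCIDES (`E.Coincides C`) — so
along `σ`'s runs in scope the boundary IS CJS's complete-transform boundary (`CanonicalNearStepσE.next_E_eq_completeTransformList`). Dischargers: normal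
flatness of the stage along the centre for members off the centre (§2, `memberCoincides_iff_of_not_le`) and `gr`-regularity of the member's initial form
along the centre for members containing it (§2, `memberCoincides_iff_of_le`). NOT a statement of the manuscript. [folklore] -/
def StrategyE.IsTransformCoincidentOnE
    (𝒮 : ∀ (W : Scheme.{u}), IsLocallyNoetherian W → Labelling W → Option (Pending W) → Boundary W → Prop)
    (N : ℕ) (ν : ℕ → ℕ) (σ : StrategyE.{u}) : Prop :=
  ∀ (W : Scheme.{u}) (hW : IsLocallyNoetherian W) (L : Labelling W) (P : Option (Pending W)) (E : Boundary W), 𝒮 W hW L P E →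
    ∀ (C : W.IdealSheafData) (P' : Option (Pending (blowup C))), σ.step W hW N ν L P E C P' → E.Coincides C

variable {𝒮 𝒮' : ∀ (W : Scheme.{u}), IsLocallyNoetherian W → Labelling W → Option (Pending W) → Boundary W → Prop} {σ π τ : StrategyE.{u}}

/-- Antitone in the scope. [folklore] -/
theorem StrategyE.IsTransformCoincidentOnE.mono (h : σ.IsTransformCoincidentOnE 𝒮 N ν)
    (h𝒮 : ∀ (W : Scheme.{u}) (hW : IsLocallyNoetherian W) (L : Labelling W) (P : Option (Pending W)) (E : Boundary W),
      𝒮' W hW L P E → 𝒮 W hW L P E) :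
    σ.IsTransformCoincidentOnE 𝒮' N ν :=
  fun W hW L P E hS C P' hs => h W hW L P E (h𝒮 W hW L P E hS) C P' hs

/-- Antitone in the strategy: fewer steps, fewer obligations. [folklore] -/
theorem StrategyE.IsTransformCoincidentOnE.of_le (h : σ.IsTransformCoincidentOnE 𝒮 N ν)
    (hle : ∀ (W : Scheme.{u}) (hW : IsLocallyNoetherian W) (L : Labelling W) (P : Option (Pending W)) (E : Boundary W) (C : W.IdealSheafData)
      (P' : Option (Pending (blowup C))), π.step W hW N ν L P E C P' → σ.step W hW N ν L P E C P') :
    π.IsTransformCoincidentOnE 𝒮 N ν :=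
  fun W hW L P E hS C P' hs => h W hW L P E hS C P' (hle W hW L P E C P' hs)

/-- **The hybrid is transform-coincident when the policy and the fallback are** (a hybrid step is a policy step or a fallback step). [folklore] -/
theorem StrategyE.IsTransformCoincidentOnE.hybrid (hπ : π.IsTransformCoincidentOnE 𝒮 N ν) (hτ : τ.IsTransformCoincidentOnE 𝒮 N ν) :
    (π.hybrid τ).IsTransformCoincidentOnE 𝒮 N ν := by
  intro W hW L P E hS C P' hs
  rcases StrategyE.hybrid_step_cases hs with h | h
  · exact hπ W hW L P E hS C P' h
  · exact hτ W hW L P E hS C P' h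

/-- **ONE σE-STEP UNDER THE OBLIGATION: the boundary of the next stage is CJS's complete transform of the current one.** [folklore] -/
theorem CanonicalNearStepσE.next_E_eq_completeTransformList {s s' : MarkedStageE.{u}} (hstep : CanonicalNearStepσE σ N ν s s')
    (hσ : σ.IsTransformCoincidentOnE 𝒮 N ν) (hs : 𝒮 s.W s.ln s.L s.P s.E) :
    ∃ (C : s.W.IdealSheafData) (P' : Option (Pending (blowup C))) (h : IsLocallyNoetherian (blowup C)) (x' : ↥(blowup C)),
      σ.step s.W s.ln N ν s.L s.P s.E C P' ∧ s.E.Coincides C ∧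
        s' = ⟨⟨blowup C, h, s.L.next (Scheme.hsStratum s.W N ν) C, P', x'⟩, completeTransformList (blowup.π C) C s.E⟩ := by
  obtain ⟨C, P', h, x', hst, -, -, -, rfl⟩ := hstep
  have hc : s.E.Coincides C := hσ s.W s.ln s.L s.P s.E hs C P' hst
  exact ⟨C, P', h, x', hst, hc, by rw [← Boundary.next_eq_completeTransformList_of_coincides hc]⟩

end Run

end Summit.ResolutionOfSingularities.ResolutionOfSingularities.Theorems.SigmaMaxModificationsCorridor3.Sigma

end
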